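import Literature.AlgebraicTopology.KTheory.BottIndex4
import HarnessLib

/-!
# The index map of Bott periodicity, V: independence of the clutching description

* units over a whole piece act trivially on the index: `indGL_pieceDn_mul : ind(B|_A g) = ind(g)`
  for `B ∈ GL_n(C(X × D₋))`, `indGL_mul_pieceUp : ind(g A|_A) = ind(g)` for `A ∈ GL_n(C(X × D₊))`
  (contract the disc: homotopy to a unit pulled back from `X`);
* **witness independence** `indGL_ext_eq_of_isClutched`: two gluing witnesses of the same
  idempotent `Q` with the same slice model `ζ` have extended transition functions
  `ũ' = B|_A ũ A|_A`, hence the same index;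
* **model independence** `indGL_ext_eq_of_isClutched'`: for slice models `ζ ∼ ζ'` the reframed
  transition `t^A g s^A` satisfies `M (ũ ⊕ 1) M = 1 ⊕ ũ'` for a base involution `M`
  (`reframe_conj`), so `ind(ũ') = ind(ũ)` (`indGL_reframe`).

Everything is proved; no named facts.

## References

* D. Husemöller, *Fibre Bundles*, 3rd ed. (1994) [HusemollerFibreBundles1994]: Ch. 11 Prop. 2.3,
  Prop. 5.3, Thm. 5.4; D. Husemöller et al., *Basic Bundle Theory and K-Cohomology Invariants*
  (2008) [HusemollerEtAl2008]: Ch. 3 §7.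
-/

noncomputable section

open Set Metric unitInterval Complex

namespace Literature.AlgebraicTopology.KTheory

open Literature.RingTheory.KTheory Matrix Pencil Linearization

universe u

variable {X : Type u} [TopologicalSpace X] [CompactSpace X] [T2Space X]
variable {n : ℕ}

/-! ### Units over the lower / upper piece act trivially on the index -/

section Pieces

/-- The section `x ↦ (x, 1)` into the lower piece. [folklore] -/
def secDn : C(X, ↥(pieceDn X)) := ⟨fun x ↦ ⟨(x, s2Base), mem_univ _, s2Base_mem_Ddn⟩, by fun_prop⟩

/-- The section `x ↦ (x, 1)` into the upper piece. [folklore] -/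
def secUp : C(X, ↥(pieceUp X)) := ⟨fun x ↦ ⟨(x, s2Base), mem_univ _, s2Base_mem_Dup⟩, by fun_prop⟩

/-- A homotopy of the lower piece, re-parametrised over the lower piece of `X × [0,1]`. [folklore] -/
def homDn (H : (ContinuousMap.id ↥(pieceDn X)).Homotopy (sliceRetract s2Base s2Base_mem_Ddn)) :
    C(↥(pieceDn (X × I)), ↥(pieceDn X)) :=
  ⟨fun z ↦ H (z.1.1.2, ⟨(z.1.1.1, z.1.2), mem_univ _, z.2.2⟩), by fun_prop⟩

/-- A homotopy of the upper piece, re-parametrised over the upper piece of `X × [0,1]`. [folklore] -/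
def homUp (H : (ContinuousMap.id ↥(pieceUp X)).Homotopy (sliceRetract s2Base s2Base_mem_Dup)) :
    C(↥(pieceUp (X × I)), ↥(pieceUp X)) :=
  ⟨fun z ↦ H (z.1.1.2, ⟨(z.1.1.1, z.1.2), mem_univ _, z.2.2⟩), by fun_prop⟩

omit [CompactSpace X] [T2Space X] in
/-- Slices of `homDn`: at `t`, the map `A → pieceDn`, `z ↦ H(t, z)`. [folklore] -/
theorem homDn_slice (H : (ContinuousMap.id ↥(pieceDn X)).Homotopy (sliceRetract s2Base s2Base_mem_Ddn)) (B : Matrix (Fin n) (Fin n) C(↥(pieceDn X), ℂ)) (t : I) :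
    (((B.map (comapRingHom (homDn H))).map (ovl₂ (pieceUp (X × I)) (pieceDn (X × I)))).map (comapRingHom (sliceOverlap t))) =
      B.map (comapRingHom ⟨fun z : ↥(pieceUp X ∩ pieceDn X) ↦ H (t, ⟨z.1, mem_univ _, z.2.2.2⟩), by fun_prop⟩) := by
  ext i j z; rfl

omit [CompactSpace X] [T2Space X] in
/-- Auxiliary statement for the index map of Bott periodicity. [folklore] -/
theorem homUp_slice (H : (ContinuousMap.id ↥(pieceUp X)).Homotopy (sliceRetract s2Base s2Base_mem_Dup)) (B : Matrix (Fin n) (Fin n) C(↥(pieceUp X), ℂ)) (t : I) :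
    (((B.map (comapRingHom (homUp H))).map (ovl₁ (pieceUp (X × I)) (pieceDn (X × I)))).map (comapRingHom (sliceOverlap t))) =
      B.map (comapRingHom ⟨fun z : ↥(pieceUp X ∩ pieceDn X) ↦ H (t, ⟨z.1, mem_univ _, z.2.1.2⟩), by fun_prop⟩) := by
  ext i j z; rfl

omit [CompactSpace X] [T2Space X] in
/-- Auxiliary statement for the index map of Bott periodicity. [folklore] -/
theorem map_fstOverlap_slice (g : Matrix (Fin n) (Fin n) C(↥(pieceUp X ∩ pieceDn X), ℂ)) (t : I) :
    (g.map (comapRingHom fstOverlap)).map (comapRingHom (sliceOverlap t)) = g := by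
  ext i j z; rfl

/-- **A unit over the lower piece acts trivially on the index from the left**:
`ind(B|_A · g) = ind(g)`. [cite: HusemollerFibreBundles1994, Ch. 11 Prop. 5.3] -/
theorem indGL_pieceDn_mul {B : Matrix (Fin n) (Fin n) C(↥(pieceDn X), ℂ)} (hB : IsUnit B) {g : Matrix (Fin n) (Fin n) C(↥(pieceUp X ∩ pieceDn X), ℂ)}
    (hg : IsUnit g) : indGL (B.map (ovl₂ (pieceUp X) (pieceDn X)) * g) = indGL g := by
  obtain ⟨H⟩ := homotopic_id_sliceRetract (X := X) (D := Ddn) s2Base s2Base_mem_Ddn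
  set G := (B.map (comapRingHom (homDn H))).map (ovl₂ (pieceUp (X × I)) (pieceDn (X × I))) * g.map (comapRingHom fstOverlap)
  have hG : IsUnit G := ((hB.map (RingHom.mapMatrix _)).map (RingHom.mapMatrix _)).mul (hg.map (RingHom.mapMatrix _))
  have key := indGL_slice_eq hG 0 1
  rw [Matrix.map_mul, Matrix.map_mul, homDn_slice, homDn_slice, map_fstOverlap_slice, map_fstOverlap_slice] at key
  have e0 : (⟨fun z : ↥(pieceUp X ∩ pieceDn X) ↦ H (0, ⟨z.1, mem_univ _, z.2.2.2⟩), by fun_prop⟩ : C(↥(pieceUp X ∩ pieceDn X), ↥(pieceDn X))) =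
      inclOfSubset inter_subset_right := by
    ext z : 1; rw [ContinuousMap.coe_mk, H.apply_zero]; rfl
  have e1 : (⟨fun z : ↥(pieceUp X ∩ pieceDn X) ↦ H (1, ⟨z.1, mem_univ _, z.2.2.2⟩), by fun_prop⟩ : C(↥(pieceUp X ∩ pieceDn X), ↥(pieceDn X))) =
      secDn.comp πA := by
    ext z : 1; rw [ContinuousMap.coe_mk, H.apply_one]; rfl
  have e2 : B.map (comapRingHom (secDn.comp πA)) = liftA (B.map (comapRingHom secDn)) := by
    rw [liftA, Matrix.map_map]; rfl
  have hB' : IsUnit (B.map (comapRingHom secDn)) := hB.map (RingHom.mapMatrix _)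
  rw [e0, e1, e2, indGL_baseUnit_mul_left hg hB'] at key
  exact key

/-- **A unit over the upper piece acts trivially on the index from the right**:
`ind(g · A|_A) = ind(g)`. [cite: HusemollerFibreBundles1994, Ch. 11 Prop. 5.3] -/
theorem indGL_mul_pieceUp {A : Matrix (Fin n) (Fin n) C(↥(pieceUp X), ℂ)} (hA : IsUnit A) {g : Matrix (Fin n) (Fin n) C(↥(pieceUp X ∩ pieceDn X), ℂ)}
    (hg : IsUnit g) : indGL (g * A.map (ovl₁ (pieceUp X) (pieceDn X))) = indGL g := by
  obtain ⟨H⟩ := homotopic_id_sliceRetract (X := X) (D := Dup) s2Base s2Base_mem_Dup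
  set G := g.map (comapRingHom fstOverlap) * (A.map (comapRingHom (homUp H))).map (ovl₁ (pieceUp (X × I)) (pieceDn (X × I)))
  have hG : IsUnit G := (hg.map (RingHom.mapMatrix _)).mul ((hA.map (RingHom.mapMatrix _)).map (RingHom.mapMatrix _))
  have key := indGL_slice_eq hG 0 1
  rw [Matrix.map_mul, Matrix.map_mul, homUp_slice, homUp_slice, map_fstOverlap_slice, map_fstOverlap_slice] at key
  have e0 : (⟨fun z : ↥(pieceUp X ∩ pieceDn X) ↦ H (0, ⟨z.1, mem_univ _, z.2.1.2⟩), by fun_prop⟩ : C(↥(pieceUp X ∩ pieceDn X), ↥(pieceUp X))) =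
      inclOfSubset inter_subset_left := by
    ext z : 1; rw [ContinuousMap.coe_mk, H.apply_zero]; rfl
  have e1 : (⟨fun z : ↥(pieceUp X ∩ pieceDn X) ↦ H (1, ⟨z.1, mem_univ _, z.2.1.2⟩), by fun_prop⟩ : C(↥(pieceUp X ∩ pieceDn X), ↥(pieceUp X))) =
      secUp.comp πA := by
    ext z : 1; rw [ContinuousMap.coe_mk, H.apply_one]; rfl
  have e2 : A.map (comapRingHom (secUp.comp πA)) = liftA (A.map (comapRingHom secUp)) := by
    rw [liftA, Matrix.map_map]; rfl
  have hA' : IsUnit (A.map (comapRingHom secUp)) := hA.map (RingHom.mapMatrix _)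
  rw [e0, e1, e2, indGL_mul_baseUnit_right hg hA'] at key
  exact key

end Pieces

/-! ### Witness independence: two gluing witnesses of the same idempotent give the same index -/

section Witness

variable {m : Type*} [Fintype m] {Q : Matrix m m C(X × S2r, ℂ)} {ζ : Idem C(X, ℂ)}

omit [CompactSpace X] [T2Space X] in
/-- The extension `ũ = u + (1 - Z)` only depends on `u`. [folklore] -/
theorem ClutchingFn.ext_eq_of_u_eq {c c' : ClutchingFn ζ} (h : c.u = c'.u) : c.ext = c'.ext := by
  rw [ClutchingFn.ext, ClutchingFn.ext, h]

omit [CompactSpace X] [T2Space X] in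
/-- **Transition functions of two gluing witnesses of the same `Q` differ by automorphisms of the
local models**: `g' = b^A g a^A` with `a = y₁ x₁'`, `b = y₂' x₂`. [cite: HusemollerEtAl2008, Ch. 3 §7 (7.2)] -/
theorem GluingWitness.g_eq_conj_models (w w' : GluingWitness Q (pullUp ζ) (pullDn ζ)) :
    w'.g = (w'.y₂ * w.x₂).map (ovl₂ (pieceUp X) (pieceDn X)) * w.g * (w.y₁ * w'.x₁).map (ovl₁ (pieceUp X) (pieceDn X)) := by
  rw [GluingWitness.g, GluingWitness.g, Matrix.map_mul, Matrix.map_mul]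
  have hQ : (w.x₂.map (ovl₂ (pieceUp X) (pieceDn X))) * (w.y₂.map (ovl₂ (pieceUp X) (pieceDn X))) =
      (Q.map (resHom (pieceDn X))).map (ovl₂ (pieceUp X) (pieceDn X)) := by rw [← Matrix.map_mul, w.hxy₂]
  have hQ' : (w.x₁.map (ovl₁ (pieceUp X) (pieceDn X))) * (w.y₁.map (ovl₁ (pieceUp X) (pieceDn X))) =
      (Q.map (resHom (pieceUp X))).map (ovl₁ (pieceUp X) (pieceDn X)) := by rw [← Matrix.map_mul, w.hxy₁]
  have hx : (Q.map (resHom (pieceUp X))).map (ovl₁ (pieceUp X) (pieceDn X)) * w'.x₁.map (ovl₁ (pieceUp X) (pieceDn X)) = w'.x₁.map (ovl₁ (pieceUp X) (pieceDn X)) := by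
    rw [← Matrix.map_mul, ← w'.hxy₁, w'.hx₁]
  have hy : w'.y₂.map (ovl₂ (pieceUp X) (pieceDn X)) * (Q.map (resHom (pieceDn X))).map (ovl₂ (pieceUp X) (pieceDn X)) = w'.y₂.map (ovl₂ (pieceUp X) (pieceDn X)) := by
    rw [← Matrix.map_mul, ← w'.hxy₂, ← Matrix.mul_assoc, w'.hy₂]
  calc w'.y₂.map (ovl₂ (pieceUp X) (pieceDn X)) * w'.x₁.map (ovl₁ (pieceUp X) (pieceDn X))
      = w'.y₂.map (ovl₂ (pieceUp X) (pieceDn X)) * ((Q.map (resHom (pieceUp X))).map (ovl₁ (pieceUp X) (pieceDn X)) * w'.x₁.map (ovl₁ (pieceUp X) (pieceDn X))) := by rw [hx]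
    _ = w'.y₂.map (ovl₂ (pieceUp X) (pieceDn X)) * (Q.map (resHom (pieceDn X))).map (ovl₂ (pieceUp X) (pieceDn X)) *
          ((Q.map (resHom (pieceUp X))).map (ovl₁ (pieceUp X) (pieceDn X)) * w'.x₁.map (ovl₁ (pieceUp X) (pieceDn X))) := by rw [hy]
    _ = w'.y₂.map (ovl₂ (pieceUp X) (pieceDn X)) * w.x₂.map (ovl₂ (pieceUp X) (pieceDn X)) *
          (w.y₂.map (ovl₂ (pieceUp X) (pieceDn X)) * w.x₁.map (ovl₁ (pieceUp X) (pieceDn X))) *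
          (w.y₁.map (ovl₁ (pieceUp X) (pieceDn X)) * w'.x₁.map (ovl₁ (pieceUp X) (pieceDn X))) := by
        rw [← hQ, ← hQ']; simp only [Matrix.mul_assoc]

omit [CompactSpace X] [T2Space X] [Fintype m] in
/-- Ring identity: `(b + (1-Z))(g + (1-Z))(a + (1-Z)) = b g a + (1-Z)` under the module relations. [folklore] -/
theorem conj_ext_identity {R : Type*} [Ring R] {Z b g a : R} (hZ : Z * Z = Z) (h1 : b * Z = b) (h2 : Z * g = g) (h3 : g * Z = g) (h4 : Z * a = a) :
    (b + (1 - Z)) * (g + (1 - Z)) * (a + (1 - Z)) = b * g * a + (1 - Z) := by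
  have e1 : (1 - Z) * (1 - Z) = 1 - Z := by rw [mul_sub, sub_mul, one_mul, mul_one, sub_mul, one_mul, hZ, sub_self, sub_zero]
  have e2 : b * (1 - Z) = 0 := by rw [mul_sub, mul_one, h1, sub_self]
  have e3 : (1 - Z) * g = 0 := by rw [sub_mul, one_mul, h2, sub_self]
  have e4 : (1 - Z) * a = 0 := by rw [sub_mul, one_mul, h4, sub_self]
  have e5 : g * (1 - Z) = 0 := by rw [mul_sub, mul_one, h3, sub_self]
  have step : (b + (1 - Z)) * (g + (1 - Z)) = b * g + (1 - Z) := by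
    rw [add_mul, mul_add, mul_add, e2, e3, e1, add_zero, zero_add]
  rw [step, add_mul, mul_add, mul_add, mul_assoc b g (1 - Z), e5, mul_zero, add_zero, e4, zero_add, e1]

omit [CompactSpace X] [T2Space X] [Fintype m] in
/-- `a + (1 - P)` is a unit when `a` is an automorphism of `im P`. [folklore] -/
theorem isUnit_add_one_sub {R : Type*} [Ring R] {P a a' : R} (hP : P * P = P) (h1 : a * a' = P) (h2 : a' * a = P) (ha : a * P = a)
    (ha' : P * a' = a') (hb : a' * P = a') (hb' : P * a = a) : IsUnit (a + (1 - P)) := by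
  have e1 : (1 - P) * (1 - P) = 1 - P := by rw [mul_sub, sub_mul, one_mul, mul_one, sub_mul, one_mul, hP, sub_self, sub_zero]
  have k1 : (a + (1 - P)) * (a' + (1 - P)) = 1 := by
    rw [add_mul, mul_add, mul_add, h1, mul_sub, mul_one, ha, sub_self, add_zero, sub_mul, one_mul, ha', sub_self, zero_add, e1, add_sub_cancel]
  have k2 : (a' + (1 - P)) * (a + (1 - P)) = 1 := by
    rw [add_mul, mul_add, mul_add, h2, mul_sub, mul_one, hb, sub_self, add_zero, sub_mul, one_mul, hb', sub_self, zero_add, e1, add_sub_cancel]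
  exact ⟨⟨_, _, k1, k2⟩, rfl⟩

omit [CompactSpace X] [T2Space X] in
/-- The automorphism `a = y₁ x₁'` of `π₊^*ζ` relating two witnesses, extended by `1`, is a unit over the upper piece. [folklore] -/
theorem GluingWitness.isUnit_aUp (w w' : GluingWitness Q (pullUp ζ) (pullDn ζ)) : IsUnit (w.y₁ * w'.x₁ + (1 - pullUp ζ)) := by
  have hP := (isIdempotentElem_pullUp ζ).eq
  have hyQ : w.y₁ * Q.map (resHom (pieceUp X)) = w.y₁ := by rw [← w.hxy₁, ← Matrix.mul_assoc, w.hy₁]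
  have hyQ' : w'.y₁ * Q.map (resHom (pieceUp X)) = w'.y₁ := by rw [← w'.hxy₁, ← Matrix.mul_assoc, w'.hy₁]
  have hQx : Q.map (resHom (pieceUp X)) * w.x₁ = w.x₁ := by rw [← w.hxy₁, w.hx₁]
  have hQx' : Q.map (resHom (pieceUp X)) * w'.x₁ = w'.x₁ := by rw [← w'.hxy₁, w'.hx₁]
  have hxP : w.x₁ * pullUp ζ = w.x₁ := by have := w.hx₁; rwa [Matrix.mul_assoc, w.hyx₁] at this
  have hxP' : w'.x₁ * pullUp ζ = w'.x₁ := by have := w'.hx₁; rwa [Matrix.mul_assoc, w'.hyx₁] at this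
  have hPy : pullUp ζ * w.y₁ = w.y₁ := by have := w.hy₁; rwa [w.hyx₁] at this
  have hPy' : pullUp ζ * w'.y₁ = w'.y₁ := by have := w'.hy₁; rwa [w'.hyx₁] at this
  refine isUnit_add_one_sub (a' := w'.y₁ * w.x₁) hP ?_ ?_ ?_ ?_ ?_ ?_
  · rw [Matrix.mul_assoc, ← Matrix.mul_assoc w'.x₁, w'.hxy₁, ← Matrix.mul_assoc, hyQ, w.hyx₁]
  · rw [Matrix.mul_assoc, ← Matrix.mul_assoc w.x₁, w.hxy₁, ← Matrix.mul_assoc, hyQ', w'.hyx₁]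
  · rw [Matrix.mul_assoc, hxP']
  · rw [← Matrix.mul_assoc, hPy']
  · rw [Matrix.mul_assoc, hxP]
  · rw [← Matrix.mul_assoc, hPy]

omit [CompactSpace X] [T2Space X] in
/-- The automorphism `b = y₂' x₂` of `π₋^*ζ`, extended by `1`, is a unit over the lower piece. [folklore] -/
theorem GluingWitness.isUnit_bDn (w w' : GluingWitness Q (pullUp ζ) (pullDn ζ)) : IsUnit (w'.y₂ * w.x₂ + (1 - pullDn ζ)) := by
  have hP := (isIdempotentElem_pullDn ζ).eq
  have hyQ : w.y₂ * Q.map (resHom (pieceDn X)) = w.y₂ := by rw [← w.hxy₂, ← Matrix.mul_assoc, w.hy₂]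
  have hyQ' : w'.y₂ * Q.map (resHom (pieceDn X)) = w'.y₂ := by rw [← w'.hxy₂, ← Matrix.mul_assoc, w'.hy₂]
  have hxP : w.x₂ * pullDn ζ = w.x₂ := by have := w.hx₂; rwa [Matrix.mul_assoc, w.hyx₂] at this
  have hxP' : w'.x₂ * pullDn ζ = w'.x₂ := by have := w'.hx₂; rwa [Matrix.mul_assoc, w'.hyx₂] at this
  have hPy : pullDn ζ * w.y₂ = w.y₂ := by have := w.hy₂; rwa [w.hyx₂] at this
  have hPy' : pullDn ζ * w'.y₂ = w'.y₂ := by have := w'.hy₂; rwa [w'.hyx₂] at this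
  refine isUnit_add_one_sub (a' := w.y₂ * w'.x₂) hP ?_ ?_ ?_ ?_ ?_ ?_
  · rw [Matrix.mul_assoc, ← Matrix.mul_assoc w.x₂, w.hxy₂, ← Matrix.mul_assoc, hyQ', w'.hyx₂]
  · rw [Matrix.mul_assoc, ← Matrix.mul_assoc w'.x₂, w'.hxy₂, ← Matrix.mul_assoc, hyQ, w.hyx₂]
  · rw [Matrix.mul_assoc, hxP]
  · rw [← Matrix.mul_assoc, hPy]
  · rw [Matrix.mul_assoc, hxP']
  · rw [← Matrix.mul_assoc, hPy']

omit [CompactSpace X] [T2Space X] in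
/-- **The extended transition functions of two witnesses differ by units over the pieces**:
`ũ' = B|_A ũ A|_A`. [cite: HusemollerFibreBundles1994, Ch. 11 Prop. 2.3] -/
theorem GluingWitness.ext_eq_conj (w w' : GluingWitness Q (pullUp ζ) (pullDn ζ)) :
    w'.g + (1 - pullA ζ) = (w'.y₂ * w.x₂ + (1 - pullDn ζ)).map (ovl₂ (pieceUp X) (pieceDn X)) * (w.g + (1 - pullA ζ)) *
      (w.y₁ * w'.x₁ + (1 - pullUp ζ)).map (ovl₁ (pieceUp X) (pieceDn X)) := by
  have hmapDn : ∀ M : Matrix (Fin ζ.size) (Fin ζ.size) C(↥(pieceDn X), ℂ), (M + (1 - pullDn ζ)).map (ovl₂ (pieceUp X) (pieceDn X)) =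
      M.map (ovl₂ (pieceUp X) (pieceDn X)) + (1 - pullA ζ) := by
    intro M; rw [Matrix.map_add _ (map_add _), Matrix.map_sub _ (map_sub _), Matrix.map_one _ (map_zero _) (map_one _), pullDn_map_ovl₂]
  have hmapUp : ∀ M : Matrix (Fin ζ.size) (Fin ζ.size) C(↥(pieceUp X), ℂ), (M + (1 - pullUp ζ)).map (ovl₁ (pieceUp X) (pieceDn X)) =
      M.map (ovl₁ (pieceUp X) (pieceDn X)) + (1 - pullA ζ) := by
    intro M; rw [Matrix.map_add _ (map_add _), Matrix.map_sub _ (map_sub _), Matrix.map_one _ (map_zero _) (map_one _), pullUp_map_ovl₁]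
  rw [hmapDn, hmapUp, GluingWitness.g_eq_conj_models w w']
  symm
  refine conj_ext_identity (isIdempotentElem_pullA ζ).eq ?_ ?_ ?_ ?_
  · -- `b^A Z = b^A`
    have hxP : w.x₂ * pullDn ζ = w.x₂ := by have := w.hx₂; rwa [Matrix.mul_assoc, w.hyx₂] at this
    rw [← pullDn_map_ovl₂, ← Matrix.map_mul, Matrix.mul_assoc, hxP]
  · -- `Z g = g`
    have hPy : pullDn ζ * w.y₂ = w.y₂ := by have := w.hy₂; rwa [w.hyx₂] at this
    rw [GluingWitness.g, ← pullDn_map_ovl₂, ← Matrix.mul_assoc, ← Matrix.map_mul, hPy]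
  · -- `g Z = g`
    have hxP : w.x₁ * pullUp ζ = w.x₁ := by have := w.hx₁; rwa [Matrix.mul_assoc, w.hyx₁] at this
    rw [GluingWitness.g, ← pullUp_map_ovl₁, Matrix.mul_assoc, ← Matrix.map_mul, hxP]
  · -- `Z a^A = a^A`
    have hPy : pullUp ζ * w.y₁ = w.y₁ := by have := w.hy₁; rwa [w.hyx₁] at this
    rw [← pullUp_map_ovl₁, ← Matrix.map_mul, ← Matrix.mul_assoc, hPy]

omit [CompactSpace X] [T2Space X] [Fintype m] in
/-- Auxiliary statement for the index map of Bott periodicity. [folklore] -/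
theorem ClutchingFn.isUnit_ext (c : ClutchingFn ζ) : IsUnit c.ext := ⟨⟨_, _, c.ext_mul_extInv, c.extInv_mul_ext⟩, rfl⟩

/-- **Witness independence of the index**: two clutching functions of the same idempotent `Q`
(w.r.t. the same `ζ`) have extended transition functions with the same index. [cite: HusemollerFibreBundles1994, Ch. 11 Prop. 5.3] -/
theorem indGL_ext_eq_of_isClutched {c c' : ClutchingFn ζ} (hc : IsClutched Q ζ c) (hc' : IsClutched Q ζ c') : indGL c'.ext = indGL c.ext := by
  obtain ⟨w, hw⟩ := hc
  obtain ⟨w', hw'⟩ := hc'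
  have e : c'.ext = (w'.y₂ * w.x₂ + (1 - pullDn ζ)).map (ovl₂ (pieceUp X) (pieceDn X)) * c.ext *
      (w.y₁ * w'.x₁ + (1 - pullUp ζ)).map (ovl₁ (pieceUp X) (pieceDn X)) := by
    rw [ClutchingFn.ext, ClutchingFn.ext, ← hw, ← hw']
    exact w.ext_eq_conj w'
  have hB : IsUnit ((w'.y₂ * w.x₂ + (1 - pullDn ζ)).map (ovl₂ (pieceUp X) (pieceDn X))) :=
    (w.isUnit_bDn w').map (RingHom.mapMatrix (ovl₂ (pieceUp X) (pieceDn X)))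
  rw [e, indGL_mul_pieceUp (w.isUnit_aUp w') (hB.mul c.isUnit_ext), indGL_pieceDn_mul (w.isUnit_bDn w') c.isUnit_ext]

end Witness

/-! ### Model independence: reframing along an equivalence `ζ ∼ ζ'` over `X` -/

section Reframe

variable {N N' : ℕ}

omit [CompactSpace X] [T2Space X] in
/-- `liftA` of a block sum re-indexed to `Fin (N + N')`. [folklore] -/
theorem liftA_glSum_blocks (A : Matrix (Fin N) (Fin N) C(X, ℂ)) (B : Matrix (Fin N) (Fin N') C(X, ℂ)) (C : Matrix (Fin N') (Fin N) C(X, ℂ)) (D : Matrix (Fin N') (Fin N') C(X, ℂ)) :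
    liftA (Matrix.reindex finSumFinEquiv finSumFinEquiv (Matrix.fromBlocks A B C D)) =
      Matrix.reindex finSumFinEquiv finSumFinEquiv (Matrix.fromBlocks (A.map (comapRingHom πA)) (B.map (comapRingHom πA)) (C.map (comapRingHom πA)) (D.map (comapRingHom πA))) := by
  rw [liftA, Matrix.reindex_apply, Matrix.reindex_apply, ← Matrix.submatrix_map, Matrix.fromBlocks_map]

omit [CompactSpace X] [T2Space X] in
/-- Auxiliary statement for the index map of Bott periodicity. [folklore] -/
theorem reindex_fromBlocks_mul {R : Type*} [CommRing R] (A₁ : Matrix (Fin N) (Fin N) R) (B₁ : Matrix (Fin N) (Fin N') R) (C₁ : Matrix (Fin N') (Fin N) R)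
    (D₁ : Matrix (Fin N') (Fin N') R) (A₂ : Matrix (Fin N) (Fin N) R) (B₂ : Matrix (Fin N) (Fin N') R) (C₂ : Matrix (Fin N') (Fin N) R) (D₂ : Matrix (Fin N') (Fin N') R) :
    Matrix.reindex finSumFinEquiv finSumFinEquiv (Matrix.fromBlocks A₁ B₁ C₁ D₁) * Matrix.reindex finSumFinEquiv finSumFinEquiv (Matrix.fromBlocks A₂ B₂ C₂ D₂) =
      Matrix.reindex finSumFinEquiv finSumFinEquiv (Matrix.fromBlocks (A₁ * A₂ + B₁ * C₂) (A₁ * B₂ + B₁ * D₂) (C₁ * A₂ + D₁ * C₂) (C₁ * B₂ + D₁ * D₂)) := by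
  rw [Matrix.reindex_apply, Matrix.reindex_apply, Matrix.reindex_apply, Matrix.submatrix_mul_equiv, Matrix.fromBlocks_multiply]

variable {ζ : Idem C(X, ℂ)} {ζ' : Idem C(X, ℂ)}

/-- The base involution `M = [[1 - ζ, s], [t, 1 - ζ']]` of the reframing trick. [folklore] -/
def reframeM (ζ ζ' : Idem C(X, ℂ)) (s₀ : Matrix (Fin ζ.size) (Fin ζ'.size) C(X, ℂ)) (t₀ : Matrix (Fin ζ'.size) (Fin ζ.size) C(X, ℂ)) :
    Matrix (Fin (ζ.size + ζ'.size)) (Fin (ζ.size + ζ'.size)) C(X, ℂ) :=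
  Matrix.reindex finSumFinEquiv finSumFinEquiv (Matrix.fromBlocks (1 - ζ.mat) s₀ t₀ (1 - ζ'.mat))

omit [CompactSpace X] [T2Space X] in
/-- `M² = 1`. [folklore] -/
theorem reframeM_mul_self {s₀ : Matrix (Fin ζ.size) (Fin ζ'.size) C(X, ℂ)} {t₀ : Matrix (Fin ζ'.size) (Fin ζ.size) C(X, ℂ)} (hst : s₀ * t₀ = ζ.mat)
    (hts : t₀ * s₀ = ζ'.mat) (hs : s₀ * t₀ * s₀ = s₀) (ht : t₀ * s₀ * t₀ = t₀) : reframeM ζ ζ' s₀ t₀ * reframeM ζ ζ' s₀ t₀ = 1 := by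
  have hZ := ζ.isIdempotentElem.eq
  have hZ' := ζ'.isIdempotentElem.eq
  have h1 : ζ.mat * s₀ = s₀ := by rw [← hst, hs]
  have h2 : s₀ * ζ'.mat = s₀ := by rw [← hts, ← Matrix.mul_assoc, hs]
  have h3 : ζ'.mat * t₀ = t₀ := by rw [← hts, ht]
  have h4 : t₀ * ζ.mat = t₀ := by rw [← hst, ← Matrix.mul_assoc, ht]
  have e1 : (1 - ζ.mat) * (1 - ζ.mat) = 1 - ζ.mat := by rw [Matrix.mul_sub, Matrix.sub_mul, Matrix.one_mul, Matrix.mul_one, Matrix.sub_mul, Matrix.one_mul, hZ, sub_self, sub_zero]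
  have e1' : (1 - ζ'.mat) * (1 - ζ'.mat) = 1 - ζ'.mat := by rw [Matrix.mul_sub, Matrix.sub_mul, Matrix.one_mul, Matrix.mul_one, Matrix.sub_mul, Matrix.one_mul, hZ', sub_self, sub_zero]
  rw [reframeM, reindex_fromBlocks_mul, e1, e1', hst, hts, Matrix.sub_mul, Matrix.one_mul, h1, sub_self, zero_add, Matrix.mul_sub, Matrix.mul_one, h2,
    sub_self, Matrix.mul_sub, Matrix.mul_one, h4, sub_self, zero_add, Matrix.sub_mul, Matrix.one_mul, h3, sub_self, sub_add_cancel, add_sub_cancel,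
    Matrix.fromBlocks_one, Matrix.reindex_apply, Matrix.submatrix_one_equiv]

omit [CompactSpace X] [T2Space X] in
/-- **The reframing identity** `M (ũ ⊕ 1) M = 1 ⊕ ũ'` with `ũ = g + (1 - Z)`, `ũ' = t^A g s^A + (1 - Z')`. [folklore] -/
theorem reframe_conj {s₀ : Matrix (Fin ζ.size) (Fin ζ'.size) C(X, ℂ)} {t₀ : Matrix (Fin ζ'.size) (Fin ζ.size) C(X, ℂ)} (hst : s₀ * t₀ = ζ.mat)
    (hts : t₀ * s₀ = ζ'.mat) (hs : s₀ * t₀ * s₀ = s₀) (ht : t₀ * s₀ * t₀ = t₀) {g : Matrix (Fin ζ.size) (Fin ζ.size) C(↥(pieceUp X ∩ pieceDn X), ℂ)}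
    (hg₁ : pullA ζ * g = g) (hg₂ : g * pullA ζ = g) :
    liftA (reframeM ζ ζ' s₀ t₀) * glSum (g + (1 - pullA ζ)) 1 * liftA (reframeM ζ ζ' s₀ t₀) =
      glSum 1 ((t₀.map (comapRingHom πA)) * g * (s₀.map (comapRingHom πA)) + (1 - pullA ζ')) := by
  -- the relations, lifted to the overlap
  have L : ∀ {a b : ℕ} (M : Matrix (Fin a) (Fin b) C(X, ℂ)), M.map (comapRingHom (πA (X := X))) = M.map (comapRingHom πA) := fun _ ↦ rfl
  have hZ : pullA ζ * pullA ζ = pullA ζ := (isIdempotentElem_pullA ζ).eq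
  have hZ' : pullA ζ' * pullA ζ' = pullA ζ' := (isIdempotentElem_pullA ζ').eq
  have mst : (s₀.map (comapRingHom πA)) * (t₀.map (comapRingHom πA)) = pullA ζ := by rw [← Matrix.map_mul, hst]
  have mts : (t₀.map (comapRingHom πA)) * (s₀.map (comapRingHom πA)) = pullA ζ' := by rw [← Matrix.map_mul, hts]
  have m1 : pullA ζ * (s₀.map (comapRingHom πA)) = (s₀.map (comapRingHom πA)) := by
    rw [pullA, ← Matrix.map_mul, ← hst, hs]
  have m2 : (s₀.map (comapRingHom πA)) * pullA ζ' = (s₀.map (comapRingHom πA)) := by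
    rw [pullA, ← Matrix.map_mul, ← hts, ← Matrix.mul_assoc, hs]
  have m3 : pullA ζ' * (t₀.map (comapRingHom πA)) = (t₀.map (comapRingHom πA)) := by
    rw [pullA, ← Matrix.map_mul, ← hts, ht]
  have m4 : (t₀.map (comapRingHom πA)) * pullA ζ = (t₀.map (comapRingHom πA)) := by
    rw [pullA, ← Matrix.map_mul, ← hst, ← Matrix.mul_assoc, ht]
  have e1 : (1 - pullA ζ) * (1 - pullA ζ) = 1 - pullA ζ := by
    rw [Matrix.mul_sub, Matrix.sub_mul, Matrix.one_mul, Matrix.mul_one, Matrix.sub_mul, Matrix.one_mul, hZ, sub_self, sub_zero]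
  have e1' : (1 - pullA ζ') * (1 - pullA ζ') = 1 - pullA ζ' := by
    rw [Matrix.mul_sub, Matrix.sub_mul, Matrix.one_mul, Matrix.mul_one, Matrix.sub_mul, Matrix.one_mul, hZ', sub_self, sub_zero]
  have hM : liftA (reframeM ζ ζ' s₀ t₀) = Matrix.reindex finSumFinEquiv finSumFinEquiv (Matrix.fromBlocks (1 - pullA ζ) ((s₀.map (comapRingHom πA))) ((t₀.map (comapRingHom πA))) (1 - pullA ζ')) := by
    rw [reframeM, liftA_glSum_blocks, Matrix.map_sub _ (map_sub _), Matrix.map_sub _ (map_sub _), Matrix.map_one _ (map_zero _) (map_one _),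
      Matrix.map_one _ (map_zero _) (map_one _)]
  rw [hM, glSum, glSum, reindex_fromBlocks_mul, reindex_fromBlocks_mul]
  -- first product: `M (ũ ⊕ 1) = [[1 - Z, s], [t g, 1 - Z']]`
  have p11 : (1 - pullA ζ) * (g + (1 - pullA ζ)) + (s₀.map (comapRingHom πA)) * (0 : Matrix (Fin ζ'.size) (Fin ζ.size) C(↥(pieceUp X ∩ pieceDn X), ℂ)) = 1 - pullA ζ := by
    rw [Matrix.mul_zero, add_zero, Matrix.mul_add, e1, Matrix.sub_mul, Matrix.one_mul, hg₁, sub_self, zero_add]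
  have p12 : (1 - pullA ζ) * (0 : Matrix (Fin ζ.size) (Fin ζ'.size) C(↥(pieceUp X ∩ pieceDn X), ℂ)) + (s₀.map (comapRingHom πA)) * (1 : Matrix (Fin ζ'.size) (Fin ζ'.size) C(↥(pieceUp X ∩ pieceDn X), ℂ)) = (s₀.map (comapRingHom πA)) := by
    rw [Matrix.mul_zero, zero_add, Matrix.mul_one]
  have p21 : (t₀.map (comapRingHom πA)) * (g + (1 - pullA ζ)) + (1 - pullA ζ') * (0 : Matrix (Fin ζ'.size) (Fin ζ.size) C(↥(pieceUp X ∩ pieceDn X), ℂ)) = (t₀.map (comapRingHom πA)) * g := by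
    rw [Matrix.mul_zero, add_zero, Matrix.mul_add, Matrix.mul_sub, Matrix.mul_one, m4, sub_self, add_zero]
  have p22 : (t₀.map (comapRingHom πA)) * (0 : Matrix (Fin ζ.size) (Fin ζ'.size) C(↥(pieceUp X ∩ pieceDn X), ℂ)) + (1 - pullA ζ') * (1 : Matrix (Fin ζ'.size) (Fin ζ'.size) C(↥(pieceUp X ∩ pieceDn X), ℂ)) = 1 - pullA ζ' := by
    rw [Matrix.mul_zero, zero_add, Matrix.mul_one]
  rw [p11, p12, p21, p22]
  -- second product
  have hg₃ : g * (1 - pullA ζ) = 0 := by rw [Matrix.mul_sub, Matrix.mul_one, hg₂, sub_self]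
  congr 2
  · rw [e1, mst, sub_add_cancel]
  · rw [Matrix.mul_sub, Matrix.mul_one, m2, sub_self, Matrix.sub_mul, Matrix.one_mul, m1, sub_self, add_zero]
  · rw [Matrix.mul_assoc, hg₃, Matrix.mul_zero, zero_add, Matrix.sub_mul, Matrix.one_mul, m3, sub_self]
  · rw [e1']

omit [CompactSpace X] [T2Space X] in
/-- Auxiliary statement for the index map of Bott periodicity. [folklore] -/
theorem isUnit_of_isUnit_glSum_one_left {R : Type*} [CommRing R] {e : Matrix (Fin N') (Fin N') R} (h : IsUnit (glSum (1 : Matrix (Fin N) (Fin N) R) e)) : IsUnit e := by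
  rw [glSum] at h
  have h' := h.map (Matrix.reindexAlgEquiv R R (finSumFinEquiv (m := N) (n := N')).symm)
  rw [Matrix.coe_reindexAlgEquiv, Matrix.reindex_apply, Matrix.reindex_apply, Matrix.submatrix_submatrix, Equiv.symm_symm,
    Equiv.symm_comp_self, Matrix.submatrix_id_id] at h'
  exact (Matrix.isUnit_fromBlocks_zero₂₁.1 h').2

/-- **Reframing does not change the index**: `ind(t^A g s^A + (1 - Z')) = ind(g + (1 - Z))` for an
equivalence `(s, t) : ζ ∼ ζ'` over `X`. [cite: HusemollerFibreBundles1994, Ch. 11 Prop. 5.3] -/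
theorem indGL_reframe {s₀ : Matrix (Fin ζ.size) (Fin ζ'.size) C(X, ℂ)} {t₀ : Matrix (Fin ζ'.size) (Fin ζ.size) C(X, ℂ)} (hst : s₀ * t₀ = ζ.mat)
    (hts : t₀ * s₀ = ζ'.mat) (hs : s₀ * t₀ * s₀ = s₀) (ht : t₀ * s₀ * t₀ = t₀) {g : Matrix (Fin ζ.size) (Fin ζ.size) C(↥(pieceUp X ∩ pieceDn X), ℂ)}
    (hg₁ : pullA ζ * g = g) (hg₂ : g * pullA ζ = g) (hu : IsUnit (g + (1 - pullA ζ))) :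
    indGL (t₀.map (comapRingHom πA) * g * s₀.map (comapRingHom πA) + (1 - pullA ζ')) = indGL (g + (1 - pullA ζ)) := by
  have hM2 := reframeM_mul_self hst hts hs ht
  have hconj := reframe_conj hst hts hs ht hg₁ hg₂
  have hU : IsUnit (glSum (g + (1 - pullA ζ)) (1 : Matrix (Fin ζ'.size) (Fin ζ'.size) C(↥(pieceUp X ∩ pieceDn X), ℂ))) := isUnit_glSum hu isUnit_one
  have hV : IsUnit (glSum (1 : Matrix (Fin ζ.size) (Fin ζ.size) C(↥(pieceUp X ∩ pieceDn X), ℂ)) (t₀.map (comapRingHom πA) * g * s₀.map (comapRingHom πA) + (1 - pullA ζ'))) := by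
    rw [← hconj]
    have hMu : IsUnit (liftA (reframeM ζ ζ' s₀ t₀)) := (show IsUnit (reframeM ζ ζ' s₀ t₀) from ⟨⟨_, _, hM2, hM2⟩, rfl⟩).map (RingHom.mapMatrix _)
    exact (hMu.mul hU).mul hMu
  have hu' : IsUnit (t₀.map (comapRingHom πA) * g * s₀.map (comapRingHom πA) + (1 - pullA ζ')) := isUnit_of_isUnit_glSum_one_left hV
  have k1 := indGL_glSum hu (isUnit_one (M := Matrix (Fin ζ'.size) (Fin ζ'.size) C(↥(pieceUp X ∩ pieceDn X), ℂ)))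
  have k2 := indGL_glSum (isUnit_one (M := Matrix (Fin ζ.size) (Fin ζ.size) C(↥(pieceUp X ∩ pieceDn X), ℂ))) hu'
  rw [indGL_one, add_zero] at k1
  rw [indGL_one, zero_add, ← hconj, indGL_conj hU hM2 hM2, k1] at k2
  exact k2.symm

variable {m : Type*} [Fintype m] {Q : Matrix m m C(X × S2r, ℂ)}

omit [CompactSpace X] [T2Space X] in
/-- Relations for the reframing data pulled back along a map `π`. [folklore] -/
theorem reframe_rel {Y : Type*} [TopologicalSpace Y] (π : C(Y, X)) {s₀ : Matrix (Fin ζ.size) (Fin ζ'.size) C(X, ℂ)} {t₀ : Matrix (Fin ζ'.size) (Fin ζ.size) C(X, ℂ)}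
    (hst : s₀ * t₀ = ζ.mat) (hts : t₀ * s₀ = ζ'.mat) (hs : s₀ * t₀ * s₀ = s₀) (ht : t₀ * s₀ * t₀ = t₀) :
    s₀.map (comapRingHom π) * t₀.map (comapRingHom π) = ζ.mat.map (comapRingHom π) ∧
    t₀.map (comapRingHom π) * s₀.map (comapRingHom π) = ζ'.mat.map (comapRingHom π) ∧
    ζ.mat.map (comapRingHom π) * s₀.map (comapRingHom π) = s₀.map (comapRingHom π) ∧
    s₀.map (comapRingHom π) * ζ'.mat.map (comapRingHom π) = s₀.map (comapRingHom π) ∧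
    ζ'.mat.map (comapRingHom π) * t₀.map (comapRingHom π) = t₀.map (comapRingHom π) ∧
    t₀.map (comapRingHom π) * ζ.mat.map (comapRingHom π) = t₀.map (comapRingHom π) := by
  refine ⟨by rw [← Matrix.map_mul, hst], by rw [← Matrix.map_mul, hts], by rw [← Matrix.map_mul, ← hst, hs],
    by rw [← Matrix.map_mul, ← hts, ← Matrix.mul_assoc, hs], by rw [← Matrix.map_mul, ← hts, ht], by rw [← Matrix.map_mul, ← hst, ← Matrix.mul_assoc, ht]⟩

omit [CompactSpace X] [T2Space X] in
/-- The slice bundles of two clutching models of the same `Q` are equivalent over `X`. [cite: HusemollerFibreBundles1994, Ch. 11 Prop. 2.3] -/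
theorem GluingWitness.algEquivalent_models (w : GluingWitness Q (pullUp ζ) (pullDn ζ)) (w' : GluingWitness Q (pullUp ζ') (pullDn ζ')) :
    AlgEquivalent ζ.mat ζ'.mat := by
  have h1 : AlgEquivalent (pullUp ζ) (Q.map (resHom (pieceUp X))) := ⟨w.y₁, w.x₁, w.hyx₁, w.hxy₁, w.hy₁, w.hx₁⟩
  have h2 : AlgEquivalent (Q.map (resHom (pieceUp X))) (pullUp ζ') := ⟨w'.x₁, w'.y₁, w'.hxy₁, w'.hyx₁, w'.hx₁, w'.hy₁⟩
  have h := (h1.trans h2).map (comapRingHom (secUp (X := X)))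
  have e : ∀ ξ : Idem C(X, ℂ), (pullUp ξ).map (comapRingHom (secUp (X := X))) = ξ.mat := fun ξ ↦ by
    ext i j x; rfl
  rwa [e, e] at h

/-- **Model independence of the index**: clutching functions of the same idempotent `Q` with
respect to any two slice models `ζ, ζ'` have extended transition functions with the same index. [cite: HusemollerFibreBundles1994, Ch. 11 Prop. 5.3] -/
theorem indGL_ext_eq_of_isClutched' {c : ClutchingFn ζ} {c' : ClutchingFn ζ'} (hc : IsClutched Q ζ c) (hc' : IsClutched Q ζ' c') :
    indGL c'.ext = indGL c.ext := by
  obtain ⟨w, hw⟩ := hc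
  obtain ⟨w', hw'⟩ := id hc'
  obtain ⟨s₀, t₀, hst, hts, hs, ht⟩ := w.algEquivalent_models w'
  obtain ⟨u1, u2, u3, u4, u5, u6⟩ := reframe_rel (πUp (X := X)) hst hts hs ht
  obtain ⟨d1, d2, d3, d4, d5, d6⟩ := reframe_rel (πDn (X := X)) hst hts hs ht
  -- the reframed witness with models `π^*ζ'`
  let w₁ : GluingWitness Q (pullUp ζ') (pullDn ζ') :=
    w.reframe (s₀.map (comapRingHom πUp)) (t₀.map (comapRingHom πUp)) u1 u2 (by rw [u2, u5])
      (s₀.map (comapRingHom πDn)) (t₀.map (comapRingHom πDn)) d1 d2 (by rw [d2, d5])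
  have hg₁ : w₁.g = t₀.map (comapRingHom πA) * w.g * s₀.map (comapRingHom πA) := by
    have := w.g_reframe (s₀.map (comapRingHom πUp)) (t₀.map (comapRingHom πUp)) u1 u2 (by rw [u2, u5])
      (s₀.map (comapRingHom πDn)) (t₀.map (comapRingHom πDn)) d1 d2 (by rw [d2, d5])
    rw [Matrix.map_map, Matrix.map_map] at this
    exact this
  have hcl : IsClutched Q ζ' (ClutchingFn.ofWitness w₁) := ⟨w₁, rfl⟩
  rw [indGL_ext_eq_of_isClutched hcl hc']
  -- `ext (ofWitness w₁) = t^A g s^A + (1 - Z')`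
  have e1 : (ClutchingFn.ofWitness w₁).ext = t₀.map (comapRingHom πA) * w.g * s₀.map (comapRingHom πA) + (1 - pullA ζ') := by
    rw [ClutchingFn.ext]; exact congrArg (· + (1 - pullA ζ')) hg₁
  have e2 : c.ext = w.g + (1 - pullA ζ) := by rw [ClutchingFn.ext, hw]
  have hZg : pullA ζ * w.g = w.g := by rw [hw]; exact c.pullA_mul_u
  have hgZ : w.g * pullA ζ = w.g := by rw [hw]; exact c.u_mul_pullA
  rw [e1, e2, indGL_reframe hst hts hs ht hZg hgZ (by rw [← e2]; exact c.isUnit_ext)]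


end Reframe

end Literature.AlgebraicTopology.KTheory

end
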